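import Summits.ResolutionOfSingularities.ResolutionOfSingularities.Theses.SeparableGalois
import Summits.ResolutionOfSingularities.ResolutionOfSingularities.Theses.Descent
import Summits.ResolutionOfSingularities.ResolutionOfSingularities.Theses.WeightedInvariant
import Summits.ResolutionOfSingularities.ResolutionOfSingularities.Theses.UniformComplexity
import Summits.ResolutionOfSingularities.ResolutionOfSingularities.Theorems.WeightedInvariantDescentPerfectToAllPicoverLink
import Summits.ResolutionOfSingularities.ResolutionOfSingularities.Theorems.WeightedInvariantDescentPerfectToAllOneRootCoreReduction

/-!
# Crux attack — `SeparableGalois.DescentPerfectToAll` (stmt-ResolutionOfSingularities-0549)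

refuter-rattack-stmt-ResolutionOfSingularities-0549-0, 2026-08-17 (one cycle, route
`route-ResolutionOfSingularities-SeparableGalois`, rank 4, shared by signature with Descent r2 /
WeightedInvariant r4 / UniformComplexity r3 / … — 21 routes).

The crux: `∀ p prime, PerfectRes p → ResolutionInChar.{0} p` (resolution of every reduced separated
finite-type scheme over every PERFECT field of char `p` implies it over EVERY field of char `p`).

Everything below is sorry-free and kernel-checked (`lean check` rc 0). Findings:

* A. ELABORATION / SHARING: rc 0; the body restated standalone is `Iff.rfl`; the SeparableGalois copy
  is `rfl`-equal to the Descent / WeightedInvariant / UniformComplexity copies (`crux_eq_*`), so the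
  standing `Cruxes/DescentPerfectToAll/Disproof.lean` (gen 3, v6.1) and every landed
  `Theorems/…DescentPerfectToAll…` reduction apply verbatim to this route's decl.
* B. RESTATES-THE-SUMMIT PROBES: `S → C` holds (`crux_of_summit`) — so `C` is irrefutable unless the
  summit is false; `C → S` is NOT available: `S ↔ (∀ p prime, PerfectRes p) ∧ C`
  (`summit_iff_perfectRes_and_crux`), i.e. `C` is the summit RELATIVE to resolution over perfect
  fields; route-relative: the other two cruxes of SeparableGalois yield exactly the antecedent
  (`perfectRes_of_W_K`, extracted from `closes`), hence given `W ∧ K`, `D ↔ S`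
  (`crux_iff_summit_of_W_K`) — the route is an honest partition, `D` carries the whole imperfect-field
  residue. `¬ C ↔ ∃ p prime, PerfectRes p ∧ ¬ ResolutionInChar p` (`not_crux_iff`): a refutation
  must PROVE resolution over all perfect fields of some characteristic (open from dim 4) and exhibit a
  non-resolvable variety — unfalsifiable by instances; no finite/computable falsifier exists.
* C. VACUITY / TRIVIALITY / DEGENERATE: `simp`/`aesop`/`exact?` fail on `C` and cannot derive `False`
  from the antecedent (W.lean probes); `p.Prime` is decoration (`cruxWithoutPrime_iff`: at `p = 0`
  every field is perfect, at other non-primes no field exists); dropping `[PerfectField]` from the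
  antecedent makes the crux the identity (`cruxWithoutPerfect`); over a perfect `k` the consequent IS
  the antecedent (`crux_at_perfectField`); `X = ∅` / `X` regular are trivial instances of the
  consequent only. Quantifier order matches the informal text (per-prime implication; universe 0 on
  both sides, as the summit).
* D. INHERITED POSITION (landed, transferred here by `rfl`): `Picover → C` (`crux_of_picover`, from
  p113743) and `C ↔ one-root core given the antecedent` (`Theorems.descentPerfectToAll_iff_oneRootStepCore`);
  provable sub-cases landed: ess. finite type over a perfect field
  (`Theorems.hasResolution_of_perfectRes_of_essFiniteType`), separably exhausted fields
  (`Theorems.hasResolution_of_perfectRes_of_separablyExhausted`); residual = MacLane-obstructed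
  inseparable level (`𝔽_p((t))`, trdeg ≥ 2), Temkin 2008 Q 3.3.3 — open problem, not a misstatement.

Verdict: SURVIVES (open-problem crux, correctly typed, irrefutable relative to the summit).
-/

noncomputable section

set_option linter.dupNamespace false

open CategoryTheory CategoryTheory.Limits AlgebraicGeometry
open Literature.AlgebraicGeometry.Resolution
open Summit.ResolutionOfSingularities.ResolutionOfSingularities

namespace Summit.ResolutionOfSingularities.ResolutionOfSingularities.Cruxes.DescentPerfectToAll.CruxAttackSeparableGalois

/-- The antecedent of the crux at `p`: resolution over PERFECT fields of characteristic `p`. -/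
def PerfectRes (p : ℕ) : Prop :=
  ∀ (k : Type) [Field k] [CharP k p] [PerfectField k] (X : Scheme.{0}) (f : X ⟶ Spec (.of k)),
    IsSeparated f → LocallyOfFiniteType f → QuasiCompact f → IsReduced X → Scheme.HasResolution X

/-! ## A. Elaboration and sharing -/

theorem crux_iff :
    Theses.SeparableGalois.DescentPerfectToAll ↔
      ∀ p : ℕ, p.Prime → PerfectRes p → ResolutionInChar.{0} p := Iff.rfl

theorem crux_eq_descent :
    Theses.SeparableGalois.DescentPerfectToAll = Theses.Descent.DescentPerfectToAll := rfl

theorem crux_eq_weightedInvariant :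
    Theses.SeparableGalois.DescentPerfectToAll = Theses.WeightedInvariant.DescentPerfectToAll := rfl

theorem crux_eq_uniformComplexity :
    Theses.SeparableGalois.DescentPerfectToAll = Theses.UniformComplexity.DescentPerfectToAll := rfl

/-! ## B. Restates-the-summit probes -/

/-- `S → C`: the crux is a consequence of the summit (hence irrefutable unless the summit fails). -/
theorem crux_of_summit (h : _root_.ResolutionOfSingularities) :
    Theses.SeparableGalois.DescentPerfectToAll :=
  fun p hp _ => (_root_.ResolutionOfSingularities_iff.mp h) p hp

theorem perfectRes_of_resolutionInChar {p : ℕ} (h : ResolutionInChar.{0} p) : PerfectRes p :=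
  fun k _ _ _ X f hs hl hq hr => h k X f hs hl hq hr

/-- `S ↔ antecedent ∧ C`: the crux is the summit RELATIVE to resolution over perfect fields. -/
theorem summit_iff_perfectRes_and_crux :
    _root_.ResolutionOfSingularities ↔
      (∀ p : ℕ, p.Prime → PerfectRes p) ∧ Theses.SeparableGalois.DescentPerfectToAll :=
  ⟨fun h => ⟨fun p hp => perfectRes_of_resolutionInChar ((_root_.ResolutionOfSingularities_iff.mp h) p hp),
    crux_of_summit h⟩,
    fun ⟨hP, hC⟩ => _root_.ResolutionOfSingularities_iff.mpr fun p hp => hC p hp (hP p hp)⟩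

/-- `¬ C` unfolds to: some prime `p` with resolution over ALL perfect fields of char `p` AND a failure of
resolution in char `p` — unfalsifiable by instances. -/
theorem not_crux_iff :
    ¬ Theses.SeparableGalois.DescentPerfectToAll ↔
      ∃ p : ℕ, p.Prime ∧ PerfectRes p ∧ ¬ ResolutionInChar.{0} p := by
  rw [crux_iff]; push Not; rfl

/-- Route-relative probe: the other two cruxes of SeparableGalois give exactly the antecedent
(this is the inner part of the route's `closes`, with `hD` removed). -/
theorem perfectRes_of_W_K (hW : Theses.SeparableGalois.GaloisQuotientModels)
    (hK : Theses.SeparableGalois.WildQuotientResolution) (p : ℕ) (hp : p.Prime) : PerfectRes p := by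
  intro k _ _ _ X f hs hl hq hr
  refine Literature.AlgebraicGeometry.Resolution.ComponentGluing.hasResolution_of_forall_closeds X f
    fun Z hZ => ?_
  haveI := hZ
  obtain ⟨X₁, X', π, q, G, _, _, ρ, hπ, hbir, h1, h2, hreg, hfin, hsurj, het, hinv, horb⟩ :=
    hW p hp k _ (CategoryTheory.CategoryStruct.comp
      (AlgebraicGeometry.Scheme.IdealSheafData.vanishingIdeal Z).subschemeι f)
      inferInstance inferInstance inferInstance hZ
  have hres : Scheme.HasResolution X₁ :=
    hK p hp k X' X₁ (CategoryTheory.CategoryStruct.comp π (CategoryTheory.CategoryStruct.comp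
      (AlgebraicGeometry.Scheme.IdealSheafData.vanishingIdeal Z).subschemeι f)) q G ρ
      inferInstance inferInstance inferInstance h1 h2 hreg hfin hsurj het hinv horb
  exact Literature.AlgebraicGeometry.Resolution.ComponentGluing.Scheme.HasResolution.of_isBirational π
    hbir hres

/-- Hence, inside the route, `D` is equivalent to the summit: it carries the whole residue. -/
theorem crux_iff_summit_of_W_K (hW : Theses.SeparableGalois.GaloisQuotientModels)
    (hK : Theses.SeparableGalois.WildQuotientResolution) :
    Theses.SeparableGalois.DescentPerfectToAll ↔ _root_.ResolutionOfSingularities :=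
  ⟨Theses.SeparableGalois.closes hW hK, crux_of_summit⟩

/-! ## C. Degenerate instances / hypothesis mutation -/

/-- `p.Prime` is decoration: without it the statement is equivalent (char 0 fields are perfect; no
field has a composite or unit characteristic). -/
theorem cruxWithoutPrime_iff :
    (∀ p : ℕ, PerfectRes p → ResolutionInChar.{0} p) ↔ Theses.SeparableGalois.DescentPerfectToAll := by
  refine ⟨fun h p _ => h p, fun h p hP k _ _ X f hs hl hq hr => ?_⟩
  rcases CharP.char_is_prime_or_zero k p with hp | rfl
  · exact h p hp hP k X f hs hl hq hr
  · haveI : CharZero k := CharP.charP_to_charZero k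
    exact hP k X f hs hl hq hr

/-- Dropping `[PerfectField k]` from the antecedent makes the crux the identity. -/
theorem cruxWithoutPerfect :
    ∀ p : ℕ, p.Prime → ResolutionInChar.{0} p → ResolutionInChar.{0} p := fun _ _ h => h

/-- Dropping the antecedent altogether gives back the summit verbatim. -/
theorem cruxWithoutAntecedent_iff :
    (∀ p : ℕ, p.Prime → ResolutionInChar.{0} p) ↔ _root_.ResolutionOfSingularities :=
  _root_.ResolutionOfSingularities_iff.symm

/-- Degenerate instance: over a PERFECT ground field the consequent is the antecedent (no content). -/
theorem crux_at_perfectField (p : ℕ) (hP : PerfectRes p) (k : Type) [Field k] [CharP k p]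
    [PerfectField k] (X : Scheme.{0}) (f : X ⟶ Spec (.of k)) [IsSeparated f] [LocallyOfFiniteType f]
    [QuasiCompact f] [IsReduced X] : Scheme.HasResolution X :=
  hP k X f ‹_› ‹_› ‹_› ‹_›

/-- Degenerate instance of the consequent: a regular `X` (e.g. `∅`, `Spec k`) is its own resolution. -/
theorem consequent_of_regular (X : Scheme.{0}) (h : Scheme.IsRegular X) : Scheme.HasResolution X :=
  h.hasResolution

/-! ## D. Inherited reductions, transferred to this route's copy by `rfl` -/

/-- `Picover` (stmt-0554, route pAlteration) ⇒ this crux (landed p113743 for the WeightedInvariant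
copy; same proposition). -/
theorem crux_of_picover :
    Theses.PAlteration.Picover → Theses.SeparableGalois.DescentPerfectToAll :=
  Theorems.descentPerfectToAll_of_picover

/-- The crux is equivalent to its one-root core given the antecedent (landed, WeightedInvariant copy). -/
example := (crux_eq_weightedInvariant ▸ Theorems.descentPerfectToAll_iff_oneRootStepCore :
  Theses.SeparableGalois.DescentPerfectToAll ↔ _)

end Summit.ResolutionOfSingularities.ResolutionOfSingularities.Cruxes.DescentPerfectToAll.CruxAttackSeparableGalois
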